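import Mathlib
import HarnessLib
import Summits.HubbardSuperconductivity.HubbardSuperconductivity.Theorems.KLProgrammeKLRegimeEnginePairTransferMemberFlow
import Summits.HubbardSuperconductivity.HubbardSuperconductivity.Theorems.KLProgrammeKLRegimeEnginePairTransferMemberFlowX

/-!
# Route `KLProgramme` — ENGINE child gen 8 (stmt-HubbardSuperconductivity-20437 `KLRegimeEngineV17F2`), skeleton v2 class #5 rev 3: the DIFFERENCE of two members'
# resolved Riccati-defect classes — generic finite-sum algebra («every term carries `D`»): `klmd_phd_sub_eq`, `klmd_phx_sub_eq`, `klmd_s62_sub_eq`, `klmd_loc_sub_eq`,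
# `klmd_norm_classes_le`
# (cell gate-hubbard-kl, seat hubbard-kl-k3c1-p1 g13, technique «composed-map remainder propagation»; model-free layer under `…PairTransferMemberDefectDiff`)

WHY.  `klmd_pinnedDefect_eq_resolved` (`…PairTransferMemberResolvedDefect`) writes the PINNED Riccati defect of a class-#5 member as `𝟙_ball·((Λ_{n+1}−Λₙ)·[−½Hd −
(βL²)⁻³(PHd − PHx − 2·S62)] + LOC)` on abstract kernels `V V6 Sg Hd` with explicit weights (`Φ` running symbol, `Wd` slice derivative, `βL²ĝ_K`) and the resolved
rung rate `Br`.  For two members of the SAME frame and slice the weights differ by the symbol difference `D` (`Φ₁ = D + Φ₂`) and the rates by the `D`-rung; this file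
is the model-free algebra of the difference, class by class — `a₁K₁ − a₂K₂ = (a₁ − a₂)K₁ + a₂(K₁ − K₂)` under the class sums, with `a₁ − a₂` written as the `D`
weight: `klmd_phd_sub_eq` (ph direct), `klmd_phx_sub_eq` (ph crossed), `klmd_s62_sub_eq` (6–2), `klmd_loc_sub_eq` (localisation) — and the norm bookkeeping
`klmd_norm_classes_le` of the assembled split.  Consumed by `klmd_pinnedDefect_sub_eq` / `klmd_defectDiff_le_rows` (the ξΔ door of rows 29/30, KLTC-INDEX v9.1).
Pure algebra; nothing about the model is asserted; nothing asserts (X).3, (c), K3 or superconductivity.  0 kit · 0 lit.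
-/

noncomputable section

namespace Summit.HubbardSuperconductivity.HubbardSuperconductivity.Theorems.KLRegimeSplit

set_option linter.dupNamespace false -- summit = problem name (single-conjunct summit), D-0017

open Finset Matrix Set Literature.MathematicalPhysics.QuantumLattice Literature.Probability.LatticeModels GrassmannAlgebra
open Summit.HubbardSuperconductivity.HubbardSuperconductivity.Theorems.KLProgrammeLegKernels
open Summit.HubbardSuperconductivity.HubbardSuperconductivity.Theorems.TwoPointAssembly
open Summit.HubbardSuperconductivity.HubbardSuperconductivity.Theorems.DispersionFlow
open Summit.HubbardSuperconductivity.HubbardSuperconductivity.Theorems.KLRegimeWick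

variable (L M : ℕ) [NeZero L] [NeZero M] (β μ : ℝ) (K : TrigPolyC4v)

/-! ## §1 ph direct -/

/-- **ph-direct class difference**: with `Φ₁ = D + Φ₂`, `PHd(Φ₁,V₁) − PHd(Φ₂,V₂) = PHd(D-weights, V₁V₁) + PHd(Φ₂-weights, V₁V₁ − V₂V₂)` (pair momentum `Qm`, external
sites `x y`, pinned frequency `ω₀`). -/
theorem klmd_phd_sub_eq (Qm x y : TorusSite 2 L) (V₁ V₂ : (Fin 4 → HubbardFieldIdx L M) → ℂ) (Φ₁ Φ₂ Wd D : FreqMomentum L M → ℝ)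
    (hΦ : ∀ p : FreqMomentum L M, Φ₁ p = D p + Φ₂ p) :
    (∑ p : FreqMomentum L M, ∑ σ : Fin 2, ∑ p' : FreqMomentum L M,
            if matsubaraInt M p'.1 + matsubaraInt M (omega0 M) = matsubaraInt M p.1 + matsubaraInt M (omega0 M) ∧ p'.2 = p.2 + x - y then
              ((((((Φ₁ p) : ℝ) : ℂ) * (((β * (L : ℝ) ^ 2 : ℝ) : ℂ) * propCT L M β μ K p)) * ((((Wd p') : ℝ) : ℂ) * (((β * (L : ℝ) ^ 2 : ℝ) : ℂ) * propCT L M β μ K p'))) + (((((Wd p) :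
                      ℝ) : ℂ) * (((β * (L : ℝ) ^ 2 : ℝ) : ℂ) * propCT L M β μ K p)) * ((((Φ₁ p') : ℝ) : ℂ) * (((β * (L : ℝ) ^ 2 : ℝ) : ℂ) * propCT L M β μ K p')))) *
                (V₁ ![((p, σ), 1), ((p', σ), 0), (((omega0 M, y), 0), 0), (((omega0 M, x), 0), 1)] *
                  V₁ ![((p, σ), 0), ((p', σ), 1), ((((omega0 M).rev, Qm - y), 1), 0), ((((omega0 M).rev, Qm - x), 1), 1)])
            else 0) -
      (∑ p : FreqMomentum L M, ∑ σ : Fin 2, ∑ p' : FreqMomentum L M,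
            if matsubaraInt M p'.1 + matsubaraInt M (omega0 M) = matsubaraInt M p.1 + matsubaraInt M (omega0 M) ∧ p'.2 = p.2 + x - y then
              ((((((Φ₂ p) : ℝ) : ℂ) * (((β * (L : ℝ) ^ 2 : ℝ) : ℂ) * propCT L M β μ K p)) * ((((Wd p') : ℝ) : ℂ) * (((β * (L : ℝ) ^ 2 : ℝ) : ℂ) * propCT L M β μ K p'))) + (((((Wd p) :
                      ℝ) : ℂ) * (((β * (L : ℝ) ^ 2 : ℝ) : ℂ) * propCT L M β μ K p)) * ((((Φ₂ p') : ℝ) : ℂ) * (((β * (L : ℝ) ^ 2 : ℝ) : ℂ) * propCT L M β μ K p')))) *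
                (V₂ ![((p, σ), 1), ((p', σ), 0), (((omega0 M, y), 0), 0), (((omega0 M, x), 0), 1)] *
                  V₂ ![((p, σ), 0), ((p', σ), 1), ((((omega0 M).rev, Qm - y), 1), 0), ((((omega0 M).rev, Qm - x), 1), 1)])
            else 0) =
      (∑ p : FreqMomentum L M, ∑ σ : Fin 2, ∑ p' : FreqMomentum L M,
            if matsubaraInt M p'.1 + matsubaraInt M (omega0 M) = matsubaraInt M p.1 + matsubaraInt M (omega0 M) ∧ p'.2 = p.2 + x - y then
              ((((((D p) : ℝ) : ℂ) * (((β * (L : ℝ) ^ 2 : ℝ) : ℂ) * propCT L M β μ K p)) * ((((Wd p') : ℝ) : ℂ) * (((β * (L : ℝ) ^ 2 : ℝ) : ℂ) * propCT L M β μ K p'))) + (((((Wd p) :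
                      ℝ) : ℂ) * (((β * (L : ℝ) ^ 2 : ℝ) : ℂ) * propCT L M β μ K p)) * ((((D p') : ℝ) : ℂ) * (((β * (L : ℝ) ^ 2 : ℝ) : ℂ) * propCT L M β μ K p')))) *
                (V₁ ![((p, σ), 1), ((p', σ), 0), (((omega0 M, y), 0), 0), (((omega0 M, x), 0), 1)] *
                  V₁ ![((p, σ), 0), ((p', σ), 1), ((((omega0 M).rev, Qm - y), 1), 0), ((((omega0 M).rev, Qm - x), 1), 1)])
            else 0) +
      (∑ p : FreqMomentum L M, ∑ σ : Fin 2, ∑ p' : FreqMomentum L M,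
            if matsubaraInt M p'.1 + matsubaraInt M (omega0 M) = matsubaraInt M p.1 + matsubaraInt M (omega0 M) ∧ p'.2 = p.2 + x - y then
              ((((((Φ₂ p) : ℝ) : ℂ) * (((β * (L : ℝ) ^ 2 : ℝ) : ℂ) * propCT L M β μ K p)) * ((((Wd p') : ℝ) : ℂ) * (((β * (L : ℝ) ^ 2 : ℝ) : ℂ) * propCT L M β μ K p'))) + (((((Wd p) :
                      ℝ) : ℂ) * (((β * (L : ℝ) ^ 2 : ℝ) : ℂ) * propCT L M β μ K p)) * ((((Φ₂ p') : ℝ) : ℂ) * (((β * (L : ℝ) ^ 2 : ℝ) : ℂ) * propCT L M β μ K p')))) *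
                (V₁ ![((p, σ), 1), ((p', σ), 0), (((omega0 M, y), 0), 0), (((omega0 M, x), 0), 1)] *
                  V₁ ![((p, σ), 0), ((p', σ), 1), ((((omega0 M).rev, Qm - y), 1), 0), ((((omega0 M).rev, Qm - x), 1), 1)] -
                V₂ ![((p, σ), 1), ((p', σ), 0), (((omega0 M, y), 0), 0), (((omega0 M, x), 0), 1)] *
                  V₂ ![((p, σ), 0), ((p', σ), 1), ((((omega0 M).rev, Qm - y), 1), 0), ((((omega0 M).rev, Qm - x), 1), 1)])
            else 0) := by
  rw [← Finset.sum_sub_distrib, ← Finset.sum_add_distrib]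
  refine Finset.sum_congr rfl fun p _ => ?_
  rw [← Finset.sum_sub_distrib, ← Finset.sum_add_distrib]
  refine Finset.sum_congr rfl fun σ _ => ?_
  rw [← Finset.sum_sub_distrib, ← Finset.sum_add_distrib]
  refine Finset.sum_congr rfl fun p' _ => ?_
  split_ifs
  · simp only [hΦ]; push_cast; ring
  · simp

/-! ## §2 ph crossed -/

/-- **ph-crossed class difference** (same splitting, crossed labels / constraint). -/
theorem klmd_phx_sub_eq (Qm x y : TorusSite 2 L) (V₁ V₂ : (Fin 4 → HubbardFieldIdx L M) → ℂ) (Φ₁ Φ₂ Wd D : FreqMomentum L M → ℝ)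
    (hΦ : ∀ p : FreqMomentum L M, Φ₁ p = D p + Φ₂ p) :
    (∑ p : FreqMomentum L M, ∑ p' : FreqMomentum L M,
            if matsubaraInt M p'.1 + matsubaraInt M (omega0 M) + matsubaraInt M (omega0 M) + 1 = matsubaraInt M p.1 ∧ p'.2 = p.2 + Qm - x - y then
              ((((((Φ₁ p) : ℝ) : ℂ) * (((β * (L : ℝ) ^ 2 : ℝ) : ℂ) * propCT L M β μ K p)) * ((((Wd p') : ℝ) : ℂ) * (((β * (L : ℝ) ^ 2 : ℝ) : ℂ) * propCT L M β μ K p'))) + (((((Wd p) :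
                      ℝ) : ℂ) * (((β * (L : ℝ) ^ 2 : ℝ) : ℂ) * propCT L M β μ K p)) * ((((Φ₁ p') : ℝ) : ℂ) * (((β * (L : ℝ) ^ 2 : ℝ) : ℂ) * propCT L M β μ K p')))) *
                (V₁ ![((p, 0), 1), ((p', 1), 0), (((omega0 M, y), 0), 0), ((((omega0 M).rev, Qm - x), 1), 1)] *
                  V₁ ![((p, 0), 0), ((p', 1), 1), ((((omega0 M).rev, Qm - y), 1), 0), (((omega0 M, x), 0), 1)])
            else 0) -
      (∑ p : FreqMomentum L M, ∑ p' : FreqMomentum L M,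
            if matsubaraInt M p'.1 + matsubaraInt M (omega0 M) + matsubaraInt M (omega0 M) + 1 = matsubaraInt M p.1 ∧ p'.2 = p.2 + Qm - x - y then
              ((((((Φ₂ p) : ℝ) : ℂ) * (((β * (L : ℝ) ^ 2 : ℝ) : ℂ) * propCT L M β μ K p)) * ((((Wd p') : ℝ) : ℂ) * (((β * (L : ℝ) ^ 2 : ℝ) : ℂ) * propCT L M β μ K p'))) + (((((Wd p) :
                      ℝ) : ℂ) * (((β * (L : ℝ) ^ 2 : ℝ) : ℂ) * propCT L M β μ K p)) * ((((Φ₂ p') : ℝ) : ℂ) * (((β * (L : ℝ) ^ 2 : ℝ) : ℂ) * propCT L M β μ K p')))) *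
                (V₂ ![((p, 0), 1), ((p', 1), 0), (((omega0 M, y), 0), 0), ((((omega0 M).rev, Qm - x), 1), 1)] *
                  V₂ ![((p, 0), 0), ((p', 1), 1), ((((omega0 M).rev, Qm - y), 1), 0), (((omega0 M, x), 0), 1)])
            else 0) =
      (∑ p : FreqMomentum L M, ∑ p' : FreqMomentum L M,
            if matsubaraInt M p'.1 + matsubaraInt M (omega0 M) + matsubaraInt M (omega0 M) + 1 = matsubaraInt M p.1 ∧ p'.2 = p.2 + Qm - x - y then
              ((((((D p) : ℝ) : ℂ) * (((β * (L : ℝ) ^ 2 : ℝ) : ℂ) * propCT L M β μ K p)) * ((((Wd p') : ℝ) : ℂ) * (((β * (L : ℝ) ^ 2 : ℝ) : ℂ) * propCT L M β μ K p'))) + (((((Wd p) :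
                      ℝ) : ℂ) * (((β * (L : ℝ) ^ 2 : ℝ) : ℂ) * propCT L M β μ K p)) * ((((D p') : ℝ) : ℂ) * (((β * (L : ℝ) ^ 2 : ℝ) : ℂ) * propCT L M β μ K p')))) *
                (V₁ ![((p, 0), 1), ((p', 1), 0), (((omega0 M, y), 0), 0), ((((omega0 M).rev, Qm - x), 1), 1)] *
                  V₁ ![((p, 0), 0), ((p', 1), 1), ((((omega0 M).rev, Qm - y), 1), 0), (((omega0 M, x), 0), 1)])
            else 0) +
      (∑ p : FreqMomentum L M, ∑ p' : FreqMomentum L M,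
            if matsubaraInt M p'.1 + matsubaraInt M (omega0 M) + matsubaraInt M (omega0 M) + 1 = matsubaraInt M p.1 ∧ p'.2 = p.2 + Qm - x - y then
              ((((((Φ₂ p) : ℝ) : ℂ) * (((β * (L : ℝ) ^ 2 : ℝ) : ℂ) * propCT L M β μ K p)) * ((((Wd p') : ℝ) : ℂ) * (((β * (L : ℝ) ^ 2 : ℝ) : ℂ) * propCT L M β μ K p'))) + (((((Wd p) :
                      ℝ) : ℂ) * (((β * (L : ℝ) ^ 2 : ℝ) : ℂ) * propCT L M β μ K p)) * ((((Φ₂ p') : ℝ) : ℂ) * (((β * (L : ℝ) ^ 2 : ℝ) : ℂ) * propCT L M β μ K p')))) *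
                (V₁ ![((p, 0), 1), ((p', 1), 0), (((omega0 M, y), 0), 0), ((((omega0 M).rev, Qm - x), 1), 1)] *
                  V₁ ![((p, 0), 0), ((p', 1), 1), ((((omega0 M).rev, Qm - y), 1), 0), (((omega0 M, x), 0), 1)] -
                V₂ ![((p, 0), 1), ((p', 1), 0), (((omega0 M, y), 0), 0), ((((omega0 M).rev, Qm - x), 1), 1)] *
                  V₂ ![((p, 0), 0), ((p', 1), 1), ((((omega0 M).rev, Qm - y), 1), 0), (((omega0 M, x), 0), 1)])
            else 0) := by
  rw [← Finset.sum_sub_distrib, ← Finset.sum_add_distrib]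
  refine Finset.sum_congr rfl fun p _ => ?_
  rw [← Finset.sum_sub_distrib, ← Finset.sum_add_distrib]
  refine Finset.sum_congr rfl fun p' _ => ?_
  split_ifs
  · simp only [hΦ]; push_cast; ring
  · simp

/-! ## §3 six–two -/

/-- **6–2 class difference**: `S62(Φ₁; V6₁Sg₁) − S62(Φ₂; V6₂Sg₂) = S62(D; V6₁Sg₁) + S62(Φ₂; V6₁Sg₁ − V6₂Sg₂)` (slice line and weight line at the SAME momentum — born overlap). -/
theorem klmd_s62_sub_eq (Qm x y : TorusSite 2 L) (V6₁ V6₂ : (Fin 6 → HubbardFieldIdx L M) → ℂ) (Sg₁ Sg₂ : FreqMomentum L M → Fin 2 → ℂ)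
    (Φ₁ Φ₂ Wd D : FreqMomentum L M → ℝ) (hΦ : ∀ p : FreqMomentum L M, Φ₁ p = D p + Φ₂ p) :
    (∑ p : FreqMomentum L M, ∑ σ : Fin 2,
            (((((Wd p) : ℝ) : ℂ) * (((β * (L : ℝ) ^ 2 : ℝ) : ℂ) * propCT L M β μ K p)) * ((((Φ₁ p) : ℝ) : ℂ) * (((β * (L : ℝ) ^ 2 : ℝ) : ℂ) * propCT L M β μ K p))) *
              (V6₁ ![((p, σ), 0), ((p, σ), 1), (((omega0 M, y), 0), 0), ((((omega0 M).rev, Qm - y), 1), 0), ((((omega0 M).rev, Qm - x), 1), 1),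
                (((omega0 M, x), 0), 1)] *
                Sg₁ p σ)) -
      (∑ p : FreqMomentum L M, ∑ σ : Fin 2,
            (((((Wd p) : ℝ) : ℂ) * (((β * (L : ℝ) ^ 2 : ℝ) : ℂ) * propCT L M β μ K p)) * ((((Φ₂ p) : ℝ) : ℂ) * (((β * (L : ℝ) ^ 2 : ℝ) : ℂ) * propCT L M β μ K p))) *
              (V6₂ ![((p, σ), 0), ((p, σ), 1), (((omega0 M, y), 0), 0), ((((omega0 M).rev, Qm - y), 1), 0), ((((omega0 M).rev, Qm - x), 1), 1),
                (((omega0 M, x), 0), 1)] *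
                Sg₂ p σ)) =
      (∑ p : FreqMomentum L M, ∑ σ : Fin 2,
            (((((Wd p) : ℝ) : ℂ) * (((β * (L : ℝ) ^ 2 : ℝ) : ℂ) * propCT L M β μ K p)) * ((((D p) : ℝ) : ℂ) * (((β * (L : ℝ) ^ 2 : ℝ) : ℂ) * propCT L M β μ K p))) *
              (V6₁ ![((p, σ), 0), ((p, σ), 1), (((omega0 M, y), 0), 0), ((((omega0 M).rev, Qm - y), 1), 0), ((((omega0 M).rev, Qm - x), 1), 1),
                (((omega0 M, x), 0), 1)] *
                Sg₁ p σ)) +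
      (∑ p : FreqMomentum L M, ∑ σ : Fin 2,
            (((((Wd p) : ℝ) : ℂ) * (((β * (L : ℝ) ^ 2 : ℝ) : ℂ) * propCT L M β μ K p)) * ((((Φ₂ p) : ℝ) : ℂ) * (((β * (L : ℝ) ^ 2 : ℝ) : ℂ) * propCT L M β μ K p))) *
              (V6₁ ![((p, σ), 0), ((p, σ), 1), (((omega0 M, y), 0), 0), ((((omega0 M).rev, Qm - y), 1), 0), ((((omega0 M).rev, Qm - x), 1), 1),
                (((omega0 M, x), 0), 1)] *
                Sg₁ p σ -
              V6₂ ![((p, σ), 0), ((p, σ), 1), (((omega0 M, y), 0), 0), ((((omega0 M).rev, Qm - y), 1), 0), ((((omega0 M).rev, Qm - x), 1), 1),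
                (((omega0 M, x), 0), 1)] *
                Sg₂ p σ)) := by
  rw [← Finset.sum_sub_distrib, ← Finset.sum_add_distrib]
  refine Finset.sum_congr rfl fun p _ => ?_
  rw [← Finset.sum_sub_distrib, ← Finset.sum_add_distrib]
  refine Finset.sum_congr rfl fun σ _ => ?_
  simp only [hΦ]; push_cast; ring

/-! ## §4 localisation -/

/-- **localisation difference**: `Σ_z Br₁·LK₁ − Σ_z Br₂·LK₂ = Σ_z (D-rung rate)·LK₁ + Σ_z Br₂·(LK₁ − LK₂)` given the rate difference `Br₁ − Br₂ =` the `D`-rung rate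
(slice derivative against `D` at pair momentum `Qm`). -/
theorem klmd_loc_sub_eq (n : ℕ) (Qm x y : TorusSite 2 L) (V₁ V₂ : (Fin 4 → HubbardFieldIdx L M) → ℂ) (Wd D : FreqMomentum L M → ℝ)
    (Br₁ Br₂ : TorusSite 2 L × MatsubaraIdx M → ℂ)
    (hBr : ∀ z : TorusSite 2 L × MatsubaraIdx M, Br₁ z - Br₂ z = -(((((β * (L : ℝ) ^ 2 : ℝ) : ℂ)))⁻¹ * propCT L M β μ K (z.2, z.1) * propCT L M β μ K (z.2.rev, Qm - z.1)) * ((((klScale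
            klE0 (n + 1) - klScale klE0 n) * (-Wd (z.2, z.1) * D (z.2.rev, Qm - z.1) - D (z.2, z.1) * Wd (z.2.rev, Qm - z.1))) : ℝ) : ℂ)) :
    (∑ z : TorusSite 2 L × MatsubaraIdx M, Br₁ z *
          ((if z.1 ∈ klBall L μ 0 then
              V₁ ![(((omega0 M, z.1), 0), 0), ((((omega0 M).rev, Qm - z.1), 1), 0), ((((omega0 M).rev, Qm - x), 1), 1), (((omega0 M, x), 0), 1)] *
                V₁ ![(((omega0 M, y), 0), 0), ((((omega0 M).rev, Qm - y), 1), 0), ((((omega0 M).rev, Qm - z.1), 1), 1), (((omega0 M, z.1), 0), 1)]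
            else 0) -
            V₁ ![(((z.2, z.1), 0), 0), (((z.2.rev, Qm - z.1), 1), 0), ((((omega0 M).rev, Qm - x), 1), 1), (((omega0 M, x), 0), 1)] *
              V₁ ![(((omega0 M, y), 0), 0), ((((omega0 M).rev, Qm - y), 1), 0), (((z.2.rev, Qm - z.1), 1), 1), (((z.2, z.1), 0), 1)])) -
      (∑ z : TorusSite 2 L × MatsubaraIdx M, Br₂ z *
          ((if z.1 ∈ klBall L μ 0 then
              V₂ ![(((omega0 M, z.1), 0), 0), ((((omega0 M).rev, Qm - z.1), 1), 0), ((((omega0 M).rev, Qm - x), 1), 1), (((omega0 M, x), 0), 1)] *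
                V₂ ![(((omega0 M, y), 0), 0), ((((omega0 M).rev, Qm - y), 1), 0), ((((omega0 M).rev, Qm - z.1), 1), 1), (((omega0 M, z.1), 0), 1)]
            else 0) -
            V₂ ![(((z.2, z.1), 0), 0), (((z.2.rev, Qm - z.1), 1), 0), ((((omega0 M).rev, Qm - x), 1), 1), (((omega0 M, x), 0), 1)] *
              V₂ ![(((omega0 M, y), 0), 0), ((((omega0 M).rev, Qm - y), 1), 0), (((z.2.rev, Qm - z.1), 1), 1), (((z.2, z.1), 0), 1)])) =
      ∑ z : TorusSite 2 L × MatsubaraIdx M, (fun z : TorusSite 2 L × MatsubaraIdx M => -(((((β * (L : ℝ) ^ 2 : ℝ) : ℂ)))⁻¹ * propCT L M β μ K (z.2, z.1) * propCT L M β μ K (z.2.rev, Qm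
              - z.1)) * ((((klScale klE0 (n + 1) - klScale klE0 n) * (-Wd (z.2, z.1) * D (z.2.rev, Qm - z.1) - D (z.2, z.1) * Wd (z.2.rev, Qm - z.1))) : ℝ) : ℂ)) z *
          ((if z.1 ∈ klBall L μ 0 then
              V₁ ![(((omega0 M, z.1), 0), 0), ((((omega0 M).rev, Qm - z.1), 1), 0), ((((omega0 M).rev, Qm - x), 1), 1), (((omega0 M, x), 0), 1)] *
                V₁ ![(((omega0 M, y), 0), 0), ((((omega0 M).rev, Qm - y), 1), 0), ((((omega0 M).rev, Qm - z.1), 1), 1), (((omega0 M, z.1), 0), 1)]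
            else 0) -
            V₁ ![(((z.2, z.1), 0), 0), (((z.2.rev, Qm - z.1), 1), 0), ((((omega0 M).rev, Qm - x), 1), 1), (((omega0 M, x), 0), 1)] *
              V₁ ![(((omega0 M, y), 0), 0), ((((omega0 M).rev, Qm - y), 1), 0), (((z.2.rev, Qm - z.1), 1), 1), (((z.2, z.1), 0), 1)]) +
      ∑ z : TorusSite 2 L × MatsubaraIdx M, Br₂ z *
          (((if z.1 ∈ klBall L μ 0 then
              V₁ ![(((omega0 M, z.1), 0), 0), ((((omega0 M).rev, Qm - z.1), 1), 0), ((((omega0 M).rev, Qm - x), 1), 1), (((omega0 M, x), 0), 1)] *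
                V₁ ![(((omega0 M, y), 0), 0), ((((omega0 M).rev, Qm - y), 1), 0), ((((omega0 M).rev, Qm - z.1), 1), 1), (((omega0 M, z.1), 0), 1)]
            else 0) -
            V₁ ![(((z.2, z.1), 0), 0), (((z.2.rev, Qm - z.1), 1), 0), ((((omega0 M).rev, Qm - x), 1), 1), (((omega0 M, x), 0), 1)] *
              V₁ ![(((omega0 M, y), 0), 0), ((((omega0 M).rev, Qm - y), 1), 0), (((z.2.rev, Qm - z.1), 1), 1), (((z.2, z.1), 0), 1)]) -
            ((if z.1 ∈ klBall L μ 0 then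
              V₂ ![(((omega0 M, z.1), 0), 0), ((((omega0 M).rev, Qm - z.1), 1), 0), ((((omega0 M).rev, Qm - x), 1), 1), (((omega0 M, x), 0), 1)] *
                V₂ ![(((omega0 M, y), 0), 0), ((((omega0 M).rev, Qm - y), 1), 0), ((((omega0 M).rev, Qm - z.1), 1), 1), (((omega0 M, z.1), 0), 1)]
            else 0) -
            V₂ ![(((z.2, z.1), 0), 0), (((z.2.rev, Qm - z.1), 1), 0), ((((omega0 M).rev, Qm - x), 1), 1), (((omega0 M, x), 0), 1)] *
              V₂ ![(((omega0 M, y), 0), 0), ((((omega0 M).rev, Qm - y), 1), 0), (((z.2.rev, Qm - z.1), 1), 1), (((z.2, z.1), 0), 1)])) := by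
  rw [← Finset.sum_sub_distrib, ← Finset.sum_add_distrib]
  refine Finset.sum_congr rfl fun z _ => ?_
  dsimp only
  rw [← hBr z]
  ring

/-! ## §5 norm bookkeeping of the assembled split -/

/-- Pure normed-field bookkeeping for the ξΔ door: the assembled split `cΛ·(−½H − c3·((SD1+SD2) − (SX1+SX2) − 2(S61+S62))) + (SL1+SL2)` against nine rows. -/
theorem klmd_norm_classes_le {cΛ c3 H SD1 SD2 SX1 SX2 S61 S62 SL1 SL2 : ℂ}
    {a b Rhd Rd₁ Rd₂ Rx₁ Rx₂ R6₁ R6₂ Rl₁ Rl₂ : ℝ} (ha : ‖cΛ‖ = a) (hb : ‖c3‖ = b) (hH : ‖H‖ ≤ Rhd)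
    (hd₁ : ‖SD1‖ ≤ Rd₁) (hd₂ : ‖SD2‖ ≤ Rd₂) (hx₁ : ‖SX1‖ ≤ Rx₁) (hx₂ : ‖SX2‖ ≤ Rx₂) (h6₁ : ‖S61‖ ≤ R6₁) (h6₂ : ‖S62‖ ≤ R6₂)
    (hl₁ : ‖SL1‖ ≤ Rl₁) (hl₂ : ‖SL2‖ ≤ Rl₂) :
    ‖cΛ * (-((2 : ℂ)⁻¹ * H) - c3 * ((SD1 + SD2) - (SX1 + SX2) - 2 * (S61 + S62))) + (SL1 + SL2)‖ ≤
      a * (2⁻¹ * Rhd + b * (Rd₁ + Rd₂ + Rx₁ + Rx₂ + 2 * (R6₁ + R6₂))) + (Rl₁ + Rl₂) := by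
  have h0a : 0 ≤ a := ha ▸ norm_nonneg _
  have h0b : 0 ≤ b := hb ▸ norm_nonneg _
  have h1 : ‖(SD1 + SD2) - (SX1 + SX2) - 2 * (S61 + S62)‖ ≤ Rd₁ + Rd₂ + Rx₁ + Rx₂ + 2 * (R6₁ + R6₂) := by
    have h2 : ‖(2 : ℂ) * (S61 + S62)‖ ≤ 2 * (R6₁ + R6₂) := by
      rw [norm_mul, Complex.norm_ofNat]
      exact mul_le_mul_of_nonneg_left ((norm_add_le _ _).trans (add_le_add h6₁ h6₂)) (by norm_num)
    have h3 : ‖(SD1 + SD2) - (SX1 + SX2)‖ ≤ Rd₁ + Rd₂ + (Rx₁ + Rx₂) :=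
      (norm_sub_le _ _).trans (add_le_add ((norm_add_le _ _).trans (add_le_add hd₁ hd₂)) ((norm_add_le _ _).trans (add_le_add hx₁ hx₂)))
    have h4 := norm_sub_le ((SD1 + SD2) - (SX1 + SX2)) (2 * (S61 + S62))
    linarith
  have h2 : ‖-((2 : ℂ)⁻¹ * H) - c3 * ((SD1 + SD2) - (SX1 + SX2) - 2 * (S61 + S62))‖ ≤
      2⁻¹ * Rhd + b * (Rd₁ + Rd₂ + Rx₁ + Rx₂ + 2 * (R6₁ + R6₂)) := by
    refine (norm_sub_le _ _).trans (add_le_add ?_ ?_)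
    · rw [norm_neg, norm_mul, norm_inv, Complex.norm_ofNat]
      exact mul_le_mul_of_nonneg_left hH (by norm_num)
    · rw [norm_mul, hb]
      exact mul_le_mul_of_nonneg_left h1 h0b
  calc ‖cΛ * (-((2 : ℂ)⁻¹ * H) - c3 * ((SD1 + SD2) - (SX1 + SX2) - 2 * (S61 + S62))) + (SL1 + SL2)‖
      ≤ ‖cΛ * (-((2 : ℂ)⁻¹ * H) - c3 * ((SD1 + SD2) - (SX1 + SX2) - 2 * (S61 + S62)))‖ + ‖SL1 + SL2‖ := norm_add_le _ _
    _ ≤ a * (2⁻¹ * Rhd + b * (Rd₁ + Rd₂ + Rx₁ + Rx₂ + 2 * (R6₁ + R6₂))) + (Rl₁ + Rl₂) := by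
        refine add_le_add ?_ ((norm_add_le _ _).trans (add_le_add hl₁ hl₂))
        rw [norm_mul, ha]
        exact mul_le_mul_of_nonneg_left h2 h0a

end Summit.HubbardSuperconductivity.HubbardSuperconductivity.Theorems.KLRegimeSplit

end
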